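import Summits.ResolutionOfSingularities.ResolutionOfSingularities.Theorems.WeightedInvariantWeightedThesisHypersurfaceChoice
import Summits.ResolutionOfSingularities.ResolutionOfSingularities.Theorems.WeightedInvariantWeightedThesisHypersurfaceStrategyAssembly
import HarnessLib

/-!
# Crux `WeightedThesis` (stmt-ResolutionOfSingularities-0569): a hypersurface centre CHOICE suffices

Topic: `Summits/ResolutionOfSingularities/ResolutionOfSingularities/Theorems`. Route
`ResolutionOfSingularities/WeightedInvariant`, crux `Theses.WeightedInvariant.WeightedThesis` (resolution
of every reduced separated scheme of finite type over every PERFECT field of characteristic `p`, every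
prime `p`), line `datum-glued-split`, lead c9, RESHAPE 9 — the tower and the composition for the CHOICE
interface `HypersurfaceCentreChoice p` (`Theorems/…HypersurfaceChoice.lean`: a centre rule with `(iii)`
regular weighted centre, `(ii')` generic point off the support, `(H)` homogeneity on every torus chart of
the pair, `(T)` well-founded tower-step relation — and NO functoriality between different pairs).

RESHAPE 8 (lead c8) ran Włodarczyk's cobordant tower for a STRATEGY (functorial for smooth surjections)
by well-founded induction on the tower-step relation (`HypersurfaceStrategyTower.hasResolution_quotient_of_gradedAtlas`),
reading functoriality only through `centre_isHomogeneous_of_strategy`. Here the same induction is run for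
a CHOICE, reading `(H)` directly:

* `HypersurfaceChoiceTower.hasResolution_quotient_of_gradedAtlas` — the tower: base = `V(X)` regular ⇒
  quotient singularities ⇒ Bergh–Rydh over `k`; step = the datum-free tower lemmas
  (`…TowerGenericAmbient`, `…TowerGenericQuotient`) for the centre `C.centre f (ker i)`, homogeneous on the
  charts of the graded atlas by `(H)`, the successor pair being `Step`-below by `Step.intro`;
* `HypersurfaceChoiceTower.hasResolution_hypersurface_of_choice_field`,
  `HypersurfaceChoiceTower.hasResolution_of_choice_field`,
  `HypersurfaceChoiceTower.resolution_field_iff_berghRydh_field_of_choice` — field-wise corollaries: a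
  choice at `p = char k` and Bergh–Rydh over the perfect field `k` resolve every integral hypersurface of a
  smooth separated quasi-compact `k`-scheme, hence (hypersurface reduction of the line) every reduced
  separated `k`-scheme of finite type; given a choice, resolution over `k` ⟺ Bergh–Rydh over `k`;
* `weightedThesis_of_hypersurfaceChoice_of_forall_berghRydh_charP` (registered stub of the line, RESHAPE 9)
  — **`(∀ p prime, Nonempty (HypersurfaceCentreChoice p))` and the characteristic-`p` instances of
  Bergh–Rydh give `WeightedThesis`**; fed with `HypersurfaceCentreChoice.ofStrategy` it is the landed
  RESHAPE 8 composition.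
-/

noncomputable section

open CategoryTheory CategoryTheory.Limits AlgebraicGeometry TopologicalSpace
open Literature.AlgebraicGeometry.Resolution
open Summit.ResolutionOfSingularities.ResolutionOfSingularities.Theses.WeightedInvariant
open Summit.ResolutionOfSingularities.ResolutionOfSingularities.Theorems

set_option linter.dupNamespace false -- mandated namespace of this single-conjunct summit

/-! ## The tower over hypersurface pairs, driven by a choice, with Bergh–Rydh over one field -/

namespace Summit.ResolutionOfSingularities.ResolutionOfSingularities.Theorems.HypersurfaceChoiceTower

/-- **Every torus-quotient presentation of an integral hypersurface of `Y/k` has a resolved quotient,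
granted a hypersurface centre choice at `p = char k` and Bergh–Rydh over `k`**: well-founded induction on
the tower-step relation `HypersurfacePair.Step C.centre` (property `(T)` of the choice). If the
hypersurface `X` is regular, the quotient has finite diagonalizable quotient singularities étale-locally
(`DatumToEmbedded.quotientSingularities_of_regular`) and the hypothesis resolves it. Otherwise the chosen
centre is a regular weighted centre (`(iii)`) missing the generic point of `X` (`(ii')`) and homogeneous on
the graded charts of the presentation (`(H)`, read directly — this is the one change from the strategy
tower); the datum-free tower lemmas give the global cobordant blow-up `B₊ → Y` (smooth separated
quasi-compact), the integral strict transform, the quotient step (a blow-up `V' → V` downstairs and a graded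
atlas of rank `j + 1`), the successor pair `(B₊, σˢ(ker i)|_{B₊})` is a hypersurface pair
(`isLocallyPrincipal_strictTransformPlus`) and is `Step`-below `(Y, ker i)` (`Step.intro`), so the
induction hypothesis resolves `V'`, and `V` along the blow-up.
[cite: Wlodarczyk2022, Thm 1.1.4 (5), Thm 1.1.6; BerghRydh2019, Thm 5] -/
theorem hasResolution_quotient_of_gradedAtlas
    {p : ℕ} (C : HypersurfaceCentreChoice p) {k : Type} [Field k] [CharP k p] [PerfectField k]
    (hBR : ∀ (V : Scheme.{0}) (g : V ⟶ Spec (.of k)) [IsIntegral V] [IsSeparated g]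
      [LocallyOfFiniteType g] [QuasiCompact g],
      (∀ v : V, ∃ (A : Type) (_ : AddCommGroup A) (_ : Finite A) (_ : DecidableEq A)
        (S : Type) (_ : CommRing S) (_ : Algebra k S) (𝒮 : A → Submodule k S)
        (_ : GradedAlgebra 𝒮), Algebra.FiniteType k S ∧ Algebra.Smooth k S ∧
        ∃ φ : Spec (.of (𝒮 0)) ⟶ V, Etale φ ∧ v ∈ Set.range φ ∧
          φ ≫ g = Spec.map (CommRingCat.ofHom (algebraMap k (𝒮 0)))) →
      Scheme.HasResolution V)
    (P : HypersurfacePair k) :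
    ∀ (X V : Scheme.{0}) (i : X ⟶ P.Y) [IsClosedImmersion i] [IsIntegral X], i.ker = P.X →
      ∀ (g : V ⟶ Spec (.of k)) [IsSeparated g] [LocallyOfFiniteType g] [QuasiCompact g]
        [IsIntegral V] (q : X ⟶ V), q ≫ g = i ≫ P.f → ∀ (j : ℕ), GradedAtlas j P.f i q →
        Scheme.HasResolution V := by
  refine (C.wellFounded_step (k := k)).induction
    (C := fun P : HypersurfacePair k =>
      ∀ (X V : Scheme.{0}) (i : X ⟶ P.Y) [IsClosedImmersion i] [IsIntegral X], i.ker = P.X →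
        ∀ (g : V ⟶ Spec (.of k)) [IsSeparated g] [LocallyOfFiniteType g] [QuasiCompact g]
          [IsIntegral V] (q : X ⟶ V), q ≫ g = i ≫ P.f → ∀ (j : ℕ), GradedAtlas j P.f i q →
          Scheme.HasResolution V) P ?_
  intro P ih
  obtain ⟨Y, f, I, hI, hIi⟩ := P
  dsimp only
  intro X V i _ _ hIeq g _ _ _ _ q hq j 𝒜
  subst hIeq
  by_cases hreg : Scheme.IsRegular X
  · -- base: `X` regular ⇒ quotient singularities ⇒ Bergh–Rydh over `k`
    exact hBR V g (DatumToEmbedded.quotientSingularities_of_regular f i q g hq hreg 𝒜)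
  · -- step
    have hsing : ¬ Scheme.IsRegular i.ker.subscheme := fun h =>
      hreg ((isRegular_iff_isRegular_image i).mpr h)
    haveI : IsLocallyNoetherian Y := LocallyOfFiniteType.isLocallyNoetherian f
    have hY : Scheme.IsRegular Y := Scheme.IsRegular.of_smooth f (Scheme.isRegular_Spec (.of k))
    -- the chosen centre is a regular weighted centre missing the generic point of `X`
    have hc : (C.centre f i.ker).IsRegularWeightedCentre :=
      C.isRegularWeightedCentre_centre f i.ker hI hIi hsing
    have hξ : i (genericPoint X) ∉ (C.centre f i.ker).support :=
      C.genericPoint_not_mem_support_centre f i hI hreg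
    -- the Rees filtration of the centre
    let R' : ReesFiltration Y :=
      { ideal := (C.centre f i.ker).piece
        ideal_zero := (C.centre f i.ker).piece_zero
        antitone := antitone_piece hc
        mul_le := (C.centre f i.ker).piece_mul_le }
    -- the new ambient is smooth separated quasi-compact
    obtain ⟨hsm', hsep', hqc'⟩ :=
      WeightedThesis.GlobalCobordantPlus.smooth_πPlus_comp_of_isRegularWeightedCentre f
        (C.centre f i.ker) hc R' rfl
    haveI := hsm'; haveI := hsep'; haveI := hqc'
    -- the strict transform is integral and lies over `X`
    obtain ⟨hint', hker⟩ :=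
      DatumToEmbedded.StrictTransform.isIntegral_strictTransformPlus_of_not_mem_support i
        (C.centre f i.ker) hc R' rfl hξ
    haveI := hint'
    set I' := R'.strictTransformPlus i.ker with hI'
    -- the successor pair is a hypersurface pair
    have hI'lp : IsLocallyPrincipal I' :=
      WeightedThesis.HypersurfacePreserved.isLocallyPrincipal_strictTransformPlus hY
        (C.centre f i.ker) hc R' rfl i.ker hI
    have hI'i : IsIntegral I'.subscheme := hint'
    let i' := I'.subschemeι
    let σX : I'.subscheme ⟶ X := IsClosedImmersion.lift i (i' ≫ R'.πPlus) hker
    have hσX : σX ≫ i = i' ≫ R'.πPlus := IsClosedImmersion.lift_fac _ _ _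
    -- `(H)`: homogeneity of the chosen centre on the charts of the presentation, then the quotient step
    have hhom := fun (a : 𝒜.ι) (n : ℕ) =>
      @HypersurfaceCentreChoice.centre_isHomogeneous p C k _ _ _ Y f _ _ _ i.ker hI hIi hsing j
        (𝒜.W a) (𝒜.piece a) (𝒜.gradedRing a) (𝒜.appLE_mem a) (𝒜.isHomogeneous_ker a) n
    obtain ⟨K, hK, hstep⟩ := DatumToEmbedded.quotientStep_of_isRegularWeightedCentre f i q g hq 𝒜
      (C.centre f i.ker) hc hξ hhom R' rfl σX hσX
    -- blow `V` up along `K`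
    obtain ⟨V', ρ, hρ⟩ := exists_isBlowup V K
    haveI : IsLocallyNoetherian V := LocallyOfFiniteType.isLocallyNoetherian g
    haveI : IsProper ρ := hρ.isProper
    have hbir : IsBirational ρ := hρ.isBirational' hK
    haveI : IsIntegral V' := hρ.isIntegral hK
    obtain ⟨q', hq', ⟨𝒜'⟩⟩ := hstep V' ρ hρ
    -- the successor pair is a step below `(Y, ker i)`: the induction hypothesis resolves `V'`
    have hlt : HypersurfacePair.Step (fun ⦃Y : Scheme.{0}⦄ (f : Y ⟶ Spec (.of k)) X => C.centre f X)
        (@HypersurfacePair.mk k _ R'.plus (R'.πPlus ≫ f) hsm' hsep' hqc' I' hI'lp hI'i)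
        (@HypersurfacePair.mk k _ Y f inferInstance inferInstance inferInstance i.ker hI hIi) :=
      HypersurfacePair.Step.intro (@HypersurfacePair.mk k _ Y f inferInstance inferInstance inferInstance i.ker hI hIi) hsing R'
        rfl hsm' hsep' hqc' hI'lp hI'i
    have hV' : Scheme.HasResolution V' := by
      have hQ' := ih _ hlt
      refine hQ' I'.subscheme V' i' (Scheme.IdealSheafData.ker_subschemeι I') (ρ ≫ g) q' ?_
        (j + 1) 𝒜'
      change q' ≫ ρ ≫ g = i' ≫ R'.πPlus ≫ f
      rw [← Category.assoc, hq', Category.assoc, hq, ← Category.assoc, hσX, Category.assoc]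
    exact Scheme.HasResolution.of_isBirational ρ hbir hV'

/-! ## Choice + Bergh–Rydh over `k` ⇒ resolution over `k` -/

/-- **A hypersurface centre choice in characteristic `p` and Bergh–Rydh over the perfect field `k` of
characteristic `p` resolve every integral HYPERSURFACE of every smooth separated quasi-compact `k`-scheme**
(run `hasResolution_quotient_of_gradedAtlas` on the trivial presentation `q = 𝟙 X` of rank `0`,
`DatumToEmbedded.InitialAtlas.stub_initialAtlas`). [cite: Wlodarczyk2022, Thm 1.1.6; BerghRydh2019, Thm 5] -/
theorem hasResolution_hypersurface_of_choice_field
    {p : ℕ} (C : HypersurfaceCentreChoice p) {k : Type} [Field k] [CharP k p] [PerfectField k]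
    (hBR : ∀ (V : Scheme.{0}) (g : V ⟶ Spec (.of k)) [IsIntegral V] [IsSeparated g]
      [LocallyOfFiniteType g] [QuasiCompact g],
      (∀ v : V, ∃ (A : Type) (_ : AddCommGroup A) (_ : Finite A) (_ : DecidableEq A)
        (S : Type) (_ : CommRing S) (_ : Algebra k S) (𝒮 : A → Submodule k S)
        (_ : GradedAlgebra 𝒮), Algebra.FiniteType k S ∧ Algebra.Smooth k S ∧
        ∃ φ : Spec (.of (𝒮 0)) ⟶ V, Etale φ ∧ v ∈ Set.range φ ∧
          φ ≫ g = Spec.map (CommRingCat.ofHom (algebraMap k (𝒮 0)))) →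
      Scheme.HasResolution V)
    {Y X : Scheme.{0}} (f : Y ⟶ Spec (.of k)) [Smooth f] [IsSeparated f] [QuasiCompact f]
    (i : X ⟶ Y) [IsClosedImmersion i] [IsIntegral X] (hX : IsLocallyPrincipal i.ker) :
    Scheme.HasResolution X := by
  obtain ⟨𝒜₀⟩ := DatumToEmbedded.InitialAtlas.stub_initialAtlas f i
  haveI : IsSeparated (i ≫ f) := inferInstance
  haveI : LocallyOfFiniteType (i ≫ f) := inferInstance
  haveI : QuasiCompact (i ≫ f) := inferInstance
  exact hasResolution_quotient_of_gradedAtlas C hBR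
    (@HypersurfacePair.mk k _ Y f inferInstance inferInstance inferInstance i.ker hX
      (HypersurfaceTower.isIntegral_ker_subscheme i))
    X X i rfl (i ≫ f) (𝟙 X) (Category.id_comp _) 0 𝒜₀

/-- **A hypersurface centre choice in characteristic `p` and Bergh–Rydh over the perfect field `k` of
characteristic `p` resolve every reduced separated `k`-scheme of finite type**
(`hasResolution_hypersurface_of_choice_field` spread by the hypersurface reduction of the line,
`HypersurfacesIff.hasResolution_of_hypersurfaces`: irreducible components, Chow's lemma, hypersurface
models by generic projection / graph closures, finite birational transfer).
[cite: Wlodarczyk2022, Thm 1.1.6; BerghRydh2019, Thm 5; Kollar2007, Prop. 2.48 (proof)] -/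
theorem hasResolution_of_choice_field
    {p : ℕ} (hp : p.Prime) (C : HypersurfaceCentreChoice p) {k : Type} [Field k] [CharP k p]
    [PerfectField k]
    (hBR : ∀ (V : Scheme.{0}) (g : V ⟶ Spec (.of k)) [IsIntegral V] [IsSeparated g]
      [LocallyOfFiniteType g] [QuasiCompact g],
      (∀ v : V, ∃ (A : Type) (_ : AddCommGroup A) (_ : Finite A) (_ : DecidableEq A)
        (S : Type) (_ : CommRing S) (_ : Algebra k S) (𝒮 : A → Submodule k S)
        (_ : GradedAlgebra 𝒮), Algebra.FiniteType k S ∧ Algebra.Smooth k S ∧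
        ∃ φ : Spec (.of (𝒮 0)) ⟶ V, Etale φ ∧ v ∈ Set.range φ ∧
          φ ≫ g = Spec.map (CommRingCat.ofHom (algebraMap k (𝒮 0)))) →
      Scheme.HasResolution V)
    (X : Scheme.{0}) (f : X ⟶ Spec (.of k)) [IsSeparated f] [LocallyOfFiniteType f]
    [QuasiCompact f] [IsReduced X] : Scheme.HasResolution X :=
  Summit.ResolutionOfSingularities.ResolutionOfSingularities.Theorems.WeightedThesis.HypersurfacesIff.hasResolution_of_hypersurfaces hp k
    (fun Y H g j hg hs hq hj hint hpr => by
      haveI := hg; haveI := hs; haveI := hq; haveI := hj; haveI := hint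
      exact hasResolution_hypersurface_of_choice_field C hBR g j
        (isLocallyPrincipal_of_forall_isPrincipal hpr)) X f

/-- **The field-wise residue of the crux with a hypersurface centre CHOICE.** Over a perfect field `k` of
characteristic `p` carrying a hypersurface centre choice `C : HypersurfaceCentreChoice p`, resolution of
every reduced separated `k`-scheme of finite type is EQUIVALENT to Bergh–Rydh's theorem over `k` (`→`
forgets the quotient charts; `←` is the tower driven by `C`).
[cite: Wlodarczyk2022, Thm 1.1.6; BerghRydh2019, Thm 5] -/
theorem resolution_field_iff_berghRydh_field_of_choice
    {p : ℕ} (hp : p.Prime) (C : HypersurfaceCentreChoice p) (k : Type) [Field k] [CharP k p]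
    [PerfectField k] :
    (∀ (X : Scheme.{0}) (f : X ⟶ Spec (.of k)), IsSeparated f → LocallyOfFiniteType f →
      QuasiCompact f → IsReduced X → Scheme.HasResolution X) ↔
    ∀ (V : Scheme.{0}) (g : V ⟶ Spec (.of k)) [IsIntegral V] [IsSeparated g]
      [LocallyOfFiniteType g] [QuasiCompact g],
      (∀ v : V, ∃ (A : Type) (_ : AddCommGroup A) (_ : Finite A) (_ : DecidableEq A)
        (S : Type) (_ : CommRing S) (_ : Algebra k S) (𝒮 : A → Submodule k S)
        (_ : GradedAlgebra 𝒮), Algebra.FiniteType k S ∧ Algebra.Smooth k S ∧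
        ∃ φ : Spec (.of (𝒮 0)) ⟶ V, Etale φ ∧ v ∈ Set.range φ ∧
          φ ≫ g = Spec.map (CommRingCat.ofHom (algebraMap k (𝒮 0)))) →
      Scheme.HasResolution V :=
  ⟨Summit.ResolutionOfSingularities.ResolutionOfSingularities.Theorems.WeightedThesis.BerghRydhCharP.berghRydh_field_of_resolution_field,
    fun hBR X f hs hl hq hr => by
    haveI := hs; haveI := hl; haveI := hq; haveI := hr
    exact hasResolution_of_choice_field hp C hBR X f⟩

end Summit.ResolutionOfSingularities.ResolutionOfSingularities.Theorems.HypersurfaceChoiceTower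

namespace Summit.ResolutionOfSingularities.ResolutionOfSingularities.Theorems

/-! ## The crux from a hypersurface CHOICE and prime-wise Bergh–Rydh -/

/-- **`WeightedThesis` from a hypersurface centre CHOICE and the characteristic-`p` instances of
Bergh–Rydh** (registered stub of line `datum-glued-split`, RESHAPE 9, crux stmt-0569): if for every prime
`p` a hypersurface centre choice exists (`Nonempty (HypersurfaceCentreChoice p)` — four obligations on each
singular integral hypersurface pair over a perfect field of characteristic `p` separately: a regular weighted
centre, off the generic point, homogeneous on every torus chart of the pair, with well-founded tower-step
relation; NO functoriality between pairs; implied by RESHAPE 8's strategy through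
`hyp_nonempty_choice_of_hypersurfaceStrategy`, hence by `WeightedConstruction`), and for every prime `p` and
every perfect field `k` of characteristic `p` every integral separated finite-type `k`-scheme with finite
diagonalizable quotient singularities étale-locally has a resolution, then every reduced separated scheme of
finite type over every perfect field of positive characteristic has a resolution.
[cite: Wlodarczyk2022, Thm 1.1.6; BerghRydh2019, Thm 5; AbramovichTemkinWlodarczyk2024, §1.9] -/
theorem weightedThesis_of_hypersurfaceChoice_of_forall_berghRydh_charP : (∀ p : ℕ, p.Prime → Nonempty (Summit.ResolutionOfSingularities.ResolutionOfSingularities.Theorems.HypersurfaceCentreChoice p)) → (∀ p : ℕ, p.Prime → ∀ (k : Type) [Field k] [CharP k p] [PerfectField k] (V : AlgebraicGeometry.Scheme.{0}) (g : V ⟶ AlgebraicGeometry.Spec (.of k)) [AlgebraicGeometry.IsIntegral V] [AlgebraicGeometry.IsSeparated g] [AlgebraicGeometry.LocallyOfFiniteType g] [AlgebraicGeometry.QuasiCompact g], (∀ v : V, ∃ (A : Type) (_ : AddCommGroup A) (_ : Finite A) (_ : DecidableEq A) (S : Type) (_ : CommRing S) (_ : Algebra k S) (𝒮 : A → Submodule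 k S) (_ : GradedAlgebra 𝒮), Algebra.FiniteType k S ∧ Algebra.Smooth k S ∧ ∃ φ : AlgebraicGeometry.Spec (.of (𝒮 0)) ⟶ V, AlgebraicGeometry.Etale φ ∧ v ∈ Set.range φ ∧ φ ≫ g = AlgebraicGeometry.Spec.map (CommRingCat.ofHom (algebraMap k (𝒮 0)))) → Literature.AlgebraicGeometry.Resolution.Scheme.HasResolution V) → Summit.ResolutionOfSingularities.ResolutionOfSingularities.Theses.WeightedInvariant.WeightedThesis := by
  intro hC hBR p hp k _ _ _ X f hs hl hq hr
  obtain ⟨C⟩ := hC p hp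
  haveI := hs; haveI := hl; haveI := hq; haveI := hr
  exact HypersurfaceChoiceTower.hasResolution_of_choice_field hp C
    (fun V g _ _ _ _ hV => hBR p hp k V g hV) X f

/-- **The RESHAPE 8 composition through the choice**: strategies at every prime and prime-wise Bergh–Rydh
give `WeightedThesis` (strategy ⇒ choice ⇒ the tower above) — the same statement as the landed
`weightedThesis_of_hypersurfaceStrategy_of_forall_berghRydh_charP`, now factored through RESHAPE 9.
[folklore] -/
theorem weightedThesis_of_hypersurfaceStrategy_of_forall_berghRydh_charP' :
    (∀ p : ℕ, p.Prime → Nonempty (HypersurfaceCentreStrategy p)) →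
    (∀ p : ℕ, p.Prime → ∀ (k : Type) [Field k] [CharP k p] [PerfectField k] (V : Scheme.{0})
      (g : V ⟶ Spec (.of k)) [IsIntegral V] [IsSeparated g] [LocallyOfFiniteType g] [QuasiCompact g],
      (∀ v : V, ∃ (A : Type) (_ : AddCommGroup A) (_ : Finite A) (_ : DecidableEq A)
        (S : Type) (_ : CommRing S) (_ : Algebra k S) (𝒮 : A → Submodule k S)
        (_ : GradedAlgebra 𝒮), Algebra.FiniteType k S ∧ Algebra.Smooth k S ∧
        ∃ φ : Spec (.of (𝒮 0)) ⟶ V, Etale φ ∧ v ∈ Set.range φ ∧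
          φ ≫ g = Spec.map (CommRingCat.ofHom (algebraMap k (𝒮 0)))) →
      Scheme.HasResolution V) →
    WeightedThesis :=
  fun hS => weightedThesis_of_hypersurfaceChoice_of_forall_berghRydh_charP
    fun p hp => HypersurfaceCentreChoice.nonempty_of_nonempty_strategy (hS p hp)

end Summit.ResolutionOfSingularities.ResolutionOfSingularities.Theorems

end
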